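import Mathlib
import HarnessLib
import Literature.AlgebraicGeometry.Ramification.InertiaNormalSylow
import Literature.AlgebraicGeometry.Resolution.ResolutionOfSingularities
import Literature.AlgebraicGeometry.Resolution.Blowups
import Literature.AlgebraicGeometry.Resolution.BlowupsExistence
import Literature.AlgebraicGeometry.Resolution.BlowupsEquivariant
import Literature.AlgebraicGeometry.Resolution.BlowupsIntegral
import Literature.AlgebraicGeometry.Resolution.BlowupsProperProofs
import Literature.AlgebraicGeometry.Resolution.RegularBlowup
import Literature.AlgebraicGeometry.Resolution.NormalCrossingsStrictification
import Literature.AlgebraicGeometry.Resolution.QuasiExcellentSchemes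
import Summits.ResolutionOfSingularities.ResolutionOfSingularities.Theorems.WildQuotientsWildQuotientResolutionStubStableAffineCoverBlowup
import Summits.ResolutionOfSingularities.ResolutionOfSingularities.Theorems.WildQuotientsWildQuotientResolutionCurveBlowupNpc

/-!
# The CURVE MOVE of Phase 0 on threefolds: blow up a regular stable curve — regular model, lifted action, stable affine cover, and NPC shrinks (crux `WildQuotients.WildQuotientResolution`)

Crux stmt-ResolutionOfSingularities-15640 (`WildQuotientResolution`), line `Sketch` (card
`p-closure-sylow-separation`), registered stub `stub_phaseZeroHighDim` (= PhaseZeroModel for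
`dim X′ ≥ 3`: a `G`-equivariant proper birational REGULAR model with p-closed inertia and a
`G`-stable affine cover). `PhaseZeroDimTwo.phaseZero_dimLE_two` is the surface case (one blow-up
of the finite NPC set). On a THREEFOLD the NPC locus has curve components; this file packages the
corresponding move with all the structural clauses of the stub: for the crux data in dimension
`≤ 3` (faithful action over the finite `q : X′ → X₁`, `X₁` separated of finite type over a field
of characteristic `p`, `X′` integral regular) and a non-zero `G`-stable ideal sheaf `𝒥` whose
subscheme is REGULAR of codimension `2` at each of its points, the blow-up `π : X♯ → X′` of `𝒥`
with the lifted action is proper, birational, `X♯` integral and REGULAR (Liu 8.1.19 (a),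
`IsBlowup.isRegular_of_isRegular_subscheme`), carries a `G`-stable affine cover
(`StableAffineCoverBlowup.stub_stableAffineCoverBlowup`), and its non-p-closed inertia lies over
the non-p-closed inertia of `X′` OFF the curve (`CurveBlowupNpc.npc_subset_of_regularCurveBlowup`):
the move strictly removes the blown-up NPC curve and creates nothing new. What remains for
`stub_phaseZeroHighDim` in dimension `3` is the combinatorics (regularising the NPC curves by
point moves, and the termination of point towers — see the crux census).

[OURS · crux stmt-ResolutionOfSingularities-15640 · helper toward `stub_phaseZeroHighDim`; counted
0; AI-level work, weaker than expert review.]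
-/

-- single-problem summit: the doubled namespace component `ResolutionOfSingularities` is forced
set_option linter.dupNamespace false

namespace Summit.ResolutionOfSingularities.ResolutionOfSingularities.Theorems.WildQuotientResolution.CurveStep

open CategoryTheory AlgebraicGeometry TopologicalSpace IsLocalRing
open Literature.AlgebraicGeometry.Resolution Literature.AlgebraicGeometry.Ramification
open Summit.ResolutionOfSingularities.ResolutionOfSingularities.Theorems.WildQuotientResolution.CurveBlowupNpc

/-- **The curve move of Phase 0 (dimension `≤ 3`).** For the crux data — `k` a field of
characteristic `p`, `X₁ → Spec k` separated of finite type, `q : X′ → X₁` finite with `X′`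
integral and regular of dimension `≤ 3`, `G` finite acting faithfully on `X′` over `q` — and a
`G`-stable ideal sheaf `𝒥 ≠ 0` with REGULAR subscheme of codimension `2` at each of its points
(`dim 𝒪_{V(𝒥),z} + 2 = dim 𝒪_{X′,z}`: a regular stable curve, or a finite set of closed points of
a surface part), the blow-up of `𝒥` with its lifted action is a `G`-equivariant proper birational
model `π : X♯ → X′` with `X♯` integral and regular, a `G`-stable affine open neighbourhood of every
point, and `NPC(X♯) ⊆ π⁻¹(NPC(X′) ∖ V(𝒥))`: a point of `X♯` with non-p-closed inertia lies over a
point of `X′` off `V(𝒥)` with non-p-closed inertia. [folklore assembly] -/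
theorem curveMove (p : ℕ) (hp : p.Prime) (k : Type) [Field k] [CharP k p]
    (X' X₁ : Scheme.{0}) (f : X₁ ⟶ Spec (.of k)) (q : X' ⟶ X₁) (G : Type) [Group G] [Finite G]
    (ρ : G →* Aut X') (hfaith : Function.Injective ρ)
    [IsSeparated f] [LocallyOfFiniteType f] [QuasiCompact f] [IsIntegral X']
    (hreg : Scheme.IsRegular X') [IsFinite q] (hρ : ∀ g : G, (ρ g).hom ≫ q = q)
    (hdim : topologicalKrullDim X' ≤ 3)
    (𝒥 : X'.IdealSheafData) (hJne : 𝒥 ≠ ⊥) (h𝒥 : ∀ g : G, 𝒥.comap (ρ g).hom = 𝒥)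
    (hC : Scheme.IsRegular 𝒥.subscheme)
    (hcodim : ∀ z ∈ 𝒥.support,
      ringKrullDim (X'.presheaf.stalk z ⧸ stalkIdeal 𝒥 z) + ((2 : ℕ) : ℕ) =
        ringKrullDim (X'.presheaf.stalk z)) :
    ∃ (Xs : Scheme.{0}) (π : Xs ⟶ X') (ρs : G →* Aut Xs), IsProper π ∧ IsBirational π ∧
      IsIntegral Xs ∧ Scheme.IsRegular Xs ∧ (∀ g : G, (ρs g).hom ≫ π = π ≫ (ρ g).hom) ∧
      IsBlowup π 𝒥 ∧
      (∀ x : Xs, ¬ HasNormalSylow p (inertiaSubgroup ρs x) →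
        π.base x ∉ 𝒥.support ∧ ¬ HasNormalSylow p (inertiaSubgroup ρ (π.base x))) ∧
      ∀ x : Xs, ∃ U : Xs.Opens, IsAffineOpen U ∧ x ∈ U ∧ ∀ g : G, (ρs g).hom ⁻¹ᵁ U = U := by
  haveI : Fact p.Prime := ⟨hp⟩
  -- `X′` is Noetherian and separated (finite over the separated finite-type `X₁/k`)
  haveI : IsLocallyNoetherian X' := LocallyOfFiniteType.isLocallyNoetherian (q ≫ f)
  haveI : X'.IsSeparated := Scheme.isSeparated_of_isSeparated_over (q ≫ f)
  -- the blow-up and the lifted action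
  obtain ⟨Xs, π, hπ⟩ := exists_isBlowup X' 𝒥
  let ρs : G →* Aut Xs := hπ.liftAction ρ h𝒥
  have hequiv : ∀ g : G, (ρs g).hom ≫ π = π ≫ (ρ g).hom := hπ.liftAction_hom_comp ρ h𝒥
  haveI hXs : IsIntegral Xs := hπ.isIntegral hJne
  haveI hπp : IsProper π := hπ.isProper
  have hbir : IsBirational π := hπ.isBirational' hJne
  -- regularity of `X♯`: Liu 8.1.19 (a)
  have hXsreg : Scheme.IsRegular Xs := hπ.isRegular_of_isRegular_subscheme hreg hC
  -- residue characteristics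
  have hcharX : ∀ z : X', CharP (ResidueField (X'.presheaf.stalk z)) p := fun z =>
    (((IsLocalRing.residue (X'.presheaf.stalk z)).comp ((X'.presheaf.germ ⊤ z trivial).hom.comp
      (((q ≫ f).appTop).hom.comp (Scheme.ΓSpecIso (.of k)).inv.hom))).charP_iff_charP p).mp
      inferInstance
  have hcharS : ∀ x : Xs, CharP (ResidueField (Xs.presheaf.stalk x)) p := fun x =>
    (((IsLocalRing.residue (Xs.presheaf.stalk x)).comp ((Xs.presheaf.germ ⊤ x trivial).hom.comp
      (((π ≫ q ≫ f).appTop).hom.comp (Scheme.ΓSpecIso (.of k)).inv.hom))).charP_iff_charP p).mp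
      inferInstance
  -- local dimensions `≤ 3`
  have hdim' : ∀ z : X', ringKrullDim (X'.presheaf.stalk z) ≤ (3 : ℕ) := fun z =>
    (ringKrullDim_stalk_le_topologicalKrullDim X' z).trans (by exact_mod_cast hdim)
  refine ⟨Xs, π, ρs, hπp, hbir, hXs, hXsreg, hequiv, hπ, fun x hx => ?_, fun x => ?_⟩
  · -- `NPC(X♯) ⊆ π⁻¹(NPC(X′) ∖ V(𝒥))`
    exact npc_subset_of_regularCurveBlowup p q ρ hfaith hρ (fun z => hreg z) hdim' 𝒥 h𝒥 hC hcodim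
      hπ ρs hequiv hcharX hcharS x hx
  · -- Mumford's cover clause
    exact StableAffineCoverBlowup.stub_stableAffineCoverBlowup q ρ hρ hπ ρs hequiv x

end Summit.ResolutionOfSingularities.ResolutionOfSingularities.Theorems.WildQuotientResolution.CurveStep
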